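/-
Copyright: b2b-lace packet (enumeration shard B, gen 12).  THE EXPONENTIAL GENERATING FUNCTION of the
`n`-step law of simple random walk on `ℤ^d` is the product of modified Bessel functions,
`Σ_m p_m(x;d) t^m/m! = ∏_μ I_{x_μ}(t/d)` — the Poissonisation identity behind the Bessel
representation of the SRW Green-function integrals.  d-generic; no numeral; no `sorry`.
-/
import Literature.Probability.FitznerVanDerHofstad2017.SrwLawKernelCount
import Literature.Probability.LatticeModels.BesselIDebyeAsymptotics
import Literature.Probability.LatticeModels.SRWHeatKernel1D
import Mathlib.Analysis.Normed.Ring.InfiniteSum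
import HarnessLib

/-!
# The exponential generating function of the SRW law: `Σ_m p_m(x;d) tᵐ/m! = ∏_μ I_{x_μ}(t/d)`

Companion of `SrwLawKernelCount.lean` (the binomial dimension recursion `SrwCount.G` and the exact
walk counts `srwCount d m x`, with `srwLaw d m x = srwCount d m x / (2d)^m`) and of the two Bessel
files of `Probability/LatticeModels` (`besselI m x = Σ_k (x/2)^{2k+|m|}/(k!(k+|m|)!)` in
`GinibreCharacterExpansion.lean`; the continuous-time kernel
`srwHeatKernel t m = (1/2π)∫_{-π}^{π} cos(km) e^{-t(1-cos k)} dk` in `SRWHeatKernel1D.lean`).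

Everything here is PROVED, `d`-generic and table-free; no named fact is introduced.

## What is here

* `SrwCount.walk1_closed`, `SrwCount.walk1_two_mul_add_natAbs` — the closed form of the
  one-dimensional count: the number of `a`-step `±1` walks from `0` to `y` is `C(a, k)` when
  `a = 2k + |y|`, and `SrwCount.walk1_eq_zero_off` — it vanishes off that progression
  (`walk1_nat_eq_zero_of_lt`: too short; `walk1_nat_eq_zero_of_odd`: wrong parity).
* `SrwCount.hasSum_walk1_egf` — **`Σ_a walk1 a y · sᵃ/a! = I_y(2s)`** (reindex `a = 2k + |y|`; the
  terms are the Bessel series terms since `C(2k+|y|,k)/(2k+|y|)! = 1/(k!(k+|y|)!)`).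
* `SrwCount.hasSum_G_egf` — the binomial dimension recursion
  `G x (j+1) m = Σ_{a+b=m} C(m,a) walk1 a x_j · G x j b` IS the Cauchy product of exponential
  generating functions, whence `Σ_m G x j m · sᵐ/m! = ∏_{i<j} I_{x_i}(2s)`; and
  `hasSum_srwCount_egf` — `Σ_m srwCount d m x · sᵐ/m! = ∏_{i : Fin d} I_{x_i}(2s)`.
* `hasSum_srwLaw_egf` — **`Σ_m p_m(x;d) tᵐ/m! = ∏_μ I_{x_μ}(t/d)`** for every `d`, `x ∈ ℤ^d`,
  `t ∈ ℝ` (absolutely convergent everywhere; `s = t/(2d)`).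
* `srwHeatKernel_eq_exp_neg_mul_besselI` — `q_u(m) = e^{-u} I_m(u)`: the tree's Fourier-form
  continuous-time kernel is the Bessel form (the `r = 0` case of the shifted-contour representation
  `besselI_eq_integral_cosh`), so that the Chernoff / local-limit bounds of `SRWHeatKernel1D.lean`
  apply to `e^{-u} I_m(u)`; `srwHeatKernel_nonneg` (`q_u(m) ≥ 0` for `u ≥ 0`) and
  `hasSum_srwHeatKernel` (`Σ_{m ∈ ℤ} q_u(m) = 1`); and `hasSum_srwLaw_poisson` — for `d ≥ 1`,
  **`e^{-t} Σ_m p_m(x;d) tᵐ/m! = ∏_μ q_{t/d}(x_μ)`**: the law of the Poissonised (rate-one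
  continuous-time) walk at time `t` factorises over the coordinates.

This is the identity used between (5.3) and (5.4) of Fitzner–van der Hofstad's computation of the
SRW integrals `I_{n,0}(x) = (1/(n-1)!) ∫₀^∞ t^{n-1} ∏_μ F(t,d,|x_μ|) dt`, `F(t,d,n) = e^{-t/d} I_n(t/d)`
(following Hara–Slade), and the classical Bessel-function representation of lattice walks
(Montroll).  The `u`-integral representation itself (one Tonelli over `(k,t)`) is NOT in this file.

## References

* R. Fitzner, R. van der Hofstad, *Generalized approach to the non-backtracking lace expansion*,
  Probab. Theory Relat. Fields 169 (2017) 1041–1119, §5.1.1, (5.2)–(5.4).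
  [cite: FitznerVanDerHofstad2016NoBLE, §5.1.1 (5.2)–(5.4)]
* T. Hara, G. Slade, *The lace expansion for self-avoiding walk in five or more dimensions*,
  Rev. Math. Phys. 4 (1992) 235–327, Appendix B (numerical evaluation of SRW quantities by Bessel
  functions). [cite: HaraSlade1992b, Appendix B]
* I. Montvay, G. Münster, *Quantum Fields on a Lattice*, CUP 1994, §3.2.7 (3.171)–(3.172) (the
  series and Fourier coefficients `I_m`). [cite: MontvayMunster1994, §3.2.7]

## Mathlib

Used: the Cauchy product on `ℕ` (`tsum_mul_tsum_eq_tsum_sum_antidiagonal_of_summable_norm`,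
`summable_sum_mul_antidiagonal_of_summable_norm'`), reindexing of series along an injection
(`Function.Injective.hasSum_iff`), `Nat.choose_mul_factorial_mul_factorial`,
`Nat.add_choose_mul_factorial_mul_factorial`, `Nat.choose_succ_succ`, `Nat.choose_symm_half`.
-/

noncomputable section

namespace Literature.Probability.FitznerVanDerHofstad2017

open Finset Real
open scoped Nat
open Literature.Barriers.CriticalPhenomena.LongRangePhi4 (srwLaw)
open Literature.Probability.LatticeModels (besselI besselITerm hasSum_besselITerm srwHeatKernel
  besselI_eq_integral_cosh)

namespace SrwCount

variable {d : ℕ}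

/-! ### The one-dimensional count in closed form -/

/-- `walk1 a y` depends on `y` only through `|y|`. [folklore] -/
theorem walk1_natAbs (a : ℕ) (y : ℤ) : walk1 a y = walk1 a (y.natAbs : ℤ) := by
  obtain ⟨n, rfl | rfl⟩ := Int.eq_nat_or_neg y
  · simp
  · rw [walk1_neg]
    simp

/-- Walks shorter than the distance: `walk1 a n = 0` for `a < n`. [folklore] -/
theorem walk1_nat_eq_zero_of_lt : ∀ (a n : ℕ), a < n → walk1 a (n : ℤ) = 0
  | 0, n, h => by
      rw [walk1_zero, if_neg (by exact_mod_cast (by omega : n ≠ 0))]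
  | a + 1, n, h => by
      obtain ⟨n', rfl⟩ : ∃ n', n = n' + 1 := ⟨n - 1, by omega⟩
      rw [walk1_succ, show ((n' + 1 : ℕ) : ℤ) - 1 = ((n' : ℕ) : ℤ) by push_cast; ring,
        show ((n' + 1 : ℕ) : ℤ) + 1 = ((n' + 2 : ℕ) : ℤ) by push_cast; ring,
        walk1_nat_eq_zero_of_lt a n' (by omega), walk1_nat_eq_zero_of_lt a (n' + 2) (by omega)]

/-- Parity: `walk1 a n = 0` unless `a ≡ n (mod 2)`. [folklore] -/
theorem walk1_nat_eq_zero_of_odd : ∀ (a n : ℕ), (a + n) % 2 = 1 → walk1 a (n : ℤ) = 0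
  | 0, n, h => by
      rw [walk1_zero, if_neg (by exact_mod_cast (by omega : n ≠ 0))]
  | a + 1, 0, h => by
      rw [walk1_succ, show ((0 : ℕ) : ℤ) - 1 = -((1 : ℕ) : ℤ) by simp, walk1_neg,
        show ((0 : ℕ) : ℤ) + 1 = ((1 : ℕ) : ℤ) by simp, walk1_nat_eq_zero_of_odd a 1 (by omega)]
  | a + 1, n' + 1, h => by
      rw [walk1_succ, show ((n' + 1 : ℕ) : ℤ) - 1 = ((n' : ℕ) : ℤ) by push_cast; ring,
        show ((n' + 1 : ℕ) : ℤ) + 1 = ((n' + 2 : ℕ) : ℤ) by push_cast; ring,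
        walk1_nat_eq_zero_of_odd a n' (by omega), walk1_nat_eq_zero_of_odd a (n' + 2) (by omega)]

/-- **Closed form on the parity progression**: for `a = 2k + n`, the number of `a`-step `±1` walks
from `0` to `n` is `C(a, k)` (choose the `k` down-steps). Proof: Pascal's rule along the last-step
recursion. [folklore] -/
theorem walk1_closed : ∀ (a k n : ℕ), a = 2 * k + n → walk1 a (n : ℤ) = a.choose k
  | 0, k, n, h => by
      obtain ⟨rfl, rfl⟩ : k = 0 ∧ n = 0 := by omega
      simp
  | a + 1, k, n, h => by
      rw [walk1_succ]
      rcases Nat.eq_zero_or_pos n with rfl | hn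
      · -- endpoint `0`: `a + 1 = 2k`, `k = k' + 1`, `a = 2k' + 1`, both neighbours are `±1`
        obtain ⟨k', rfl⟩ : ∃ k', k = k' + 1 := ⟨k - 1, by omega⟩
        have ha : a = 2 * k' + 1 := by omega
        have h1 : walk1 a (((0 : ℕ) : ℤ) - 1) = a.choose k' := by
          rw [show ((0 : ℕ) : ℤ) - 1 = -((1 : ℕ) : ℤ) by simp, walk1_neg]
          exact walk1_closed a k' 1 ha
        have h2 : walk1 a (((0 : ℕ) : ℤ) + 1) = a.choose k' := by
          rw [show ((0 : ℕ) : ℤ) + 1 = ((1 : ℕ) : ℤ) by simp]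
          exact walk1_closed a k' 1 ha
        rw [h1, h2, ha, Nat.choose_succ_succ, Nat.choose_symm_half]
      · obtain ⟨n', rfl⟩ : ∃ n', n = n' + 1 := ⟨n - 1, by omega⟩
        have h1 : walk1 a (((n' + 1 : ℕ) : ℤ) - 1) = a.choose k := by
          rw [show ((n' + 1 : ℕ) : ℤ) - 1 = ((n' : ℕ) : ℤ) by push_cast; ring]
          exact walk1_closed a k n' (by omega)
        rcases Nat.eq_zero_or_pos k with rfl | hk
        · have h2 : walk1 a (((n' + 1 : ℕ) : ℤ) + 1) = 0 := by
            rw [show ((n' + 1 : ℕ) : ℤ) + 1 = ((n' + 2 : ℕ) : ℤ) by push_cast; ring]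
            exact walk1_nat_eq_zero_of_lt a (n' + 2) (by omega)
          rw [h1, h2, Nat.choose_zero_right, Nat.choose_zero_right]
        · obtain ⟨k', rfl⟩ : ∃ k', k = k' + 1 := ⟨k - 1, by omega⟩
          have h2 : walk1 a (((n' + 1 : ℕ) : ℤ) + 1) = a.choose k' := by
            rw [show ((n' + 1 : ℕ) : ℤ) + 1 = ((n' + 2 : ℕ) : ℤ) by push_cast; ring]
            exact walk1_closed a k' (n' + 2) (by omega)
          rw [h1, h2, Nat.choose_succ_succ, add_comm]

/-- Closed form at an integer endpoint: `walk1 (2k + |y|) y = C(2k + |y|, k)`. [folklore] -/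
theorem walk1_two_mul_add_natAbs (k : ℕ) (y : ℤ) :
    walk1 (2 * k + y.natAbs) y = (2 * k + y.natAbs).choose k := by
  rw [walk1_natAbs]
  exact walk1_closed _ k _ rfl

/-- Off the progression `a = 2k + |y|` the count vanishes. [folklore] -/
theorem walk1_eq_zero_off (a : ℕ) (y : ℤ) (h : ∀ k : ℕ, a ≠ 2 * k + y.natAbs) : walk1 a y = 0 := by
  rw [walk1_natAbs]
  rcases lt_or_ge a y.natAbs with hlt | hle
  · exact walk1_nat_eq_zero_of_lt a _ hlt
  · refine walk1_nat_eq_zero_of_odd a _ ?_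
    rcases Nat.even_or_odd (a - y.natAbs) with ⟨k, hk⟩ | ⟨k, hk⟩
    · exact absurd (by omega : a = 2 * k + y.natAbs) (h k)
    · omega

/-! ### The one-dimensional exponential generating function -/

/-- `‖w · sᵃ/a!‖ = w · |s|ᵃ/a!` for a natural-number coefficient `w`. [folklore] -/
theorem norm_natCast_mul_pow_div (w a : ℕ) (s : ℝ) :
    ‖(w : ℝ) * s ^ a / (a ! : ℝ)‖ = (w : ℝ) * |s| ^ a / (a ! : ℝ) := by
  rw [norm_div, norm_mul, norm_pow, Real.norm_natCast, Real.norm_natCast, Real.norm_eq_abs]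

/-- **`Σ_a walk1 a y · sᵃ/a! = I_y(2s)`**: the exponential generating function of the one-dimensional
counts is the modified Bessel function (reindex along `a = 2k + |y|`:
`C(2k+|y|,k) s^{2k+|y|}/(2k+|y|)! = s^{2k+|y|}/(k!(k+|y|)!)`). [folklore] -/
theorem hasSum_walk1_egf (y : ℤ) (s : ℝ) :
    HasSum (fun a : ℕ => (walk1 a y : ℝ) * s ^ a / (a ! : ℝ)) (besselI y (2 * s)) := by
  have hinj : Function.Injective (fun k : ℕ => 2 * k + y.natAbs) := by
    intro k₁ k₂ h
    have h' : 2 * k₁ + y.natAbs = 2 * k₂ + y.natAbs := h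
    omega
  have hzero : ∀ a ∉ Set.range (fun k : ℕ => 2 * k + y.natAbs),
      (walk1 a y : ℝ) * s ^ a / (a ! : ℝ) = 0 := by
    intro a ha
    rw [walk1_eq_zero_off a y (fun k hk => ha ⟨k, hk.symm⟩), Nat.cast_zero, zero_mul, zero_div]
  refine (hinj.hasSum_iff hzero).1 ?_
  convert hasSum_besselITerm y (2 * s) using 1
  funext k
  simp only [Function.comp_apply, besselITerm]
  rw [walk1_two_mul_add_natAbs, mul_div_cancel_left₀ s two_ne_zero]
  have key : ((2 * k + y.natAbs).choose k : ℝ) * (k ! : ℝ) * ((k + y.natAbs)! : ℝ)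
      = ((2 * k + y.natAbs)! : ℝ) := by
    have h := Nat.choose_mul_factorial_mul_factorial (show k ≤ 2 * k + y.natAbs by omega)
    rw [show 2 * k + y.natAbs - k = k + y.natAbs by omega] at h
    exact_mod_cast h
  rw [div_eq_div_iff (by positivity) (by positivity), ← key]
  ring

/-! ### The Cauchy product over the dimensions -/

/-- The Cauchy product of two absolutely convergent real series, `HasSum` form over
`Finset.antidiagonal`. [folklore] -/
theorem hasSum_antidiagonal_of_summable_norm {u v : ℕ → ℝ} {U V : ℝ} (hu : HasSum u U)
    (hv : HasSum v V) (hu' : Summable fun a => ‖u a‖) (hv' : Summable fun b => ‖v b‖) :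
    HasSum (fun m => ∑ ab ∈ antidiagonal m, u ab.1 * v ab.2) (U * V) := by
  have hs : Summable fun m => ∑ ab ∈ antidiagonal m, u ab.1 * v ab.2 :=
    summable_sum_mul_antidiagonal_of_summable_norm' hu' hu.summable hv' hv.summable
  have h := tsum_mul_tsum_eq_tsum_sum_antidiagonal_of_summable_norm hu' hv'
  rw [hu.tsum_eq, hv.tsum_eq] at h
  rw [h]
  exact hs.hasSum

/-- **The dimension recursion as a product of exponential generating functions**:
`Σ_m G x j m · sᵐ/m! = ∏_{i<j} I_{x_i}(2s)` (the binomial convolution `G_succ` is the Cauchy product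
of exponential series, `C(m,a)/m! = 1/(a! b!)` for `a + b = m`). [folklore] -/
theorem hasSum_G_egf (x : Fin d → ℤ) : ∀ (j : ℕ) (s : ℝ),
    HasSum (fun m => (G x j m : ℝ) * s ^ m / (m ! : ℝ)) (∏ i ∈ range j, besselI (coordD x i) (2 * s))
  | 0, s => by
      rw [prod_range_zero]
      have e : (fun m => (G x 0 m : ℝ) * s ^ m / (m ! : ℝ)) = fun m => if m = 0 then (1 : ℝ) else 0 := by
        funext m
        rw [G_zero]
        split_ifs with h <;> simp [h]
      rw [e]
      exact hasSum_ite_eq 0 1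
  | j + 1, s => by
      have hw := hasSum_walk1_egf (coordD x j) s
      have hG := hasSum_G_egf x j s
      have hw' : Summable fun a => ‖(walk1 a (coordD x j) : ℝ) * s ^ a / (a ! : ℝ)‖ := by
        simp_rw [norm_natCast_mul_pow_div]
        exact (hasSum_walk1_egf (coordD x j) |s|).summable
      have hG' : Summable fun b => ‖(G x j b : ℝ) * s ^ b / (b ! : ℝ)‖ := by
        simp_rw [norm_natCast_mul_pow_div]
        exact (hasSum_G_egf x j |s|).summable
      have h := hasSum_antidiagonal_of_summable_norm hw hG hw' hG'
      rw [prod_range_succ, mul_comm (∏ i ∈ range j, besselI (coordD x i) (2 * s))]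
      convert h using 1
      funext m
      rw [G_succ, Nat.cast_sum, sum_mul, sum_div]
      refine sum_congr rfl ?_
      rintro ⟨a, b⟩ hab
      have hm : a + b = m := mem_antidiagonal.1 hab
      subst hm
      have key : ((a + b).choose a : ℝ) * (a ! : ℝ) * (b ! : ℝ) = ((a + b)! : ℝ) := by
        rw [Nat.choose_symm_add]
        exact_mod_cast Nat.add_choose_mul_factorial_mul_factorial a b
      have hC : ((a + b).choose a : ℝ) ≠ 0 := by
        exact_mod_cast (Nat.choose_pos (Nat.le_add_right a b)).ne'
      have hfa : (a ! : ℝ) ≠ 0 := by positivity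
      have hfb : (b ! : ℝ) ≠ 0 := by positivity
      push_cast
      rw [div_mul_div_comm, ← key, pow_add, div_eq_div_iff (mul_ne_zero (mul_ne_zero hC hfa) hfb)
        (mul_ne_zero hfa hfb)]
      ring

end SrwCount

open SrwCount

variable {d : ℕ}

/-- `coordD x i = x i` for `i : Fin d`. [folklore] -/
theorem coordD_fin (x : Fin d → ℤ) (i : Fin d) : coordD x i = x i := by
  simp [coordD, i.isLt]

/-- **EGF of the walk counts**: `Σ_m srwCount d m x · sᵐ/m! = ∏_{i : Fin d} I_{x_i}(2s)`. [folklore] -/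
theorem hasSum_srwCount_egf (x : Fin d → ℤ) (s : ℝ) :
    HasSum (fun m => (srwCount d m x : ℝ) * s ^ m / (m ! : ℝ)) (∏ i : Fin d, besselI (x i) (2 * s)) := by
  have h := hasSum_G_egf x d s
  rw [← Fin.prod_univ_eq_prod_range (fun i => besselI (coordD x i) (2 * s)) d] at h
  simp_rw [coordD_fin] at h
  exact h

/-- **The exponential generating function of the SRW law is the product of modified Bessel
functions**: `Σ_m p_m(x;d) tᵐ/m! = ∏_μ I_{x_μ}(t/d)` for every `d`, `x ∈ ℤ^d` and real `t`
(`p_m = srwCount/(2d)^m`, `s = t/(2d)`).  The identity between (5.3) and (5.4) of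
Fitzner–van der Hofstad (after Hara–Slade, App. B). [folklore] -/
theorem hasSum_srwLaw_egf (x : Fin d → ℤ) (t : ℝ) :
    HasSum (fun m => srwLaw d m x * t ^ m / (m ! : ℝ)) (∏ i : Fin d, besselI (x i) (t / d)) := by
  have h := hasSum_srwCount_egf x (t / (2 * d))
  rw [← mul_div_assoc, mul_div_mul_left t (d : ℝ) two_ne_zero] at h
  convert h using 2 with m
  rw [srwLaw_eq_srwCount_div, div_pow]
  ring

/-! ### The continuous-time kernel is `e^{-u} I_m(u)`; the Poissonised law factorises -/

/-- **`q_u(m) = e^{-u} I_m(u)`**: the Fourier-form heat kernel of the rate-one continuous-time simple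
random walk on `ℤ` (`SRWHeatKernel1D.srwHeatKernel`) equals the Bessel form — the case `r = 0` of the
shifted-contour representation `besselI_eq_integral_cosh`. [folklore] -/
theorem srwHeatKernel_eq_exp_neg_mul_besselI (u : ℝ) (m : ℤ) :
    srwHeatKernel u m = Real.exp (-u) * besselI m u := by
  have hI := besselI_eq_integral_cosh u 0 m
  simp only [Real.cosh_zero, Real.sinh_zero, mul_one, mul_zero, zero_mul, zero_sub, Real.cos_neg,
    neg_zero, Real.exp_zero] at hI
  rw [hI, srwHeatKernel]
  have e : ∀ k : ℝ, Real.cos (k * m) * Real.exp (-(u * (1 - Real.cos k)))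
      = Real.exp (-u) * (Real.exp (u * Real.cos k) * Real.cos (m * k)) := by
    intro k
    rw [show -(u * (1 - Real.cos k)) = -u + u * Real.cos k by ring, Real.exp_add, mul_comm k (m : ℝ)]
    ring
  simp_rw [e, intervalIntegral.integral_const_mul]
  ring

/-- The continuous-time kernel is nonnegative at nonnegative times (`e^{-u} I_m(u) ≥ 0`; not visible on
the Fourier form). [folklore] -/
theorem srwHeatKernel_nonneg {u : ℝ} (hu : 0 ≤ u) (m : ℤ) : 0 ≤ srwHeatKernel u m := by
  rw [srwHeatKernel_eq_exp_neg_mul_besselI]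
  exact mul_nonneg (Real.exp_pos _).le (Literature.Probability.LatticeModels.besselI_nonneg hu m)

/-- The continuous-time kernel is a probability distribution on `ℤ`: `Σ_{m ∈ ℤ} q_u(m) = 1`
(`Σ_m I_m(u) = e^u`, `GinibreCharacterExpansion.hasSum_besselI`). [folklore] -/
theorem hasSum_srwHeatKernel (u : ℝ) : HasSum (fun m : ℤ => srwHeatKernel u m) 1 := by
  simp_rw [srwHeatKernel_eq_exp_neg_mul_besselI]
  have h := (Literature.Probability.LatticeModels.hasSum_besselI u).mul_left (Real.exp (-u))
  rwa [← Real.exp_add, neg_add_cancel, Real.exp_zero] at h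

/-- **The Poissonised law factorises**: for `d ≥ 1`, `x ∈ ℤ^d`, real `t`,
`e^{-t} Σ_m p_m(x;d) tᵐ/m! = ∏_μ q_{t/d}(x_μ)` — the position at time `t` of the rate-one
continuous-time simple random walk on `ℤ^d` has independent coordinates, each a rate-`1/d` walk on
`ℤ` (`F(t,d,n) = e^{-t/d} I_n(t/d)` of Fitzner–van der Hofstad (5.2)). [folklore] -/
theorem hasSum_srwLaw_poisson (hd : 1 ≤ d) (x : Fin d → ℤ) (t : ℝ) :
    HasSum (fun m => Real.exp (-t) * (srwLaw d m x * t ^ m / (m ! : ℝ)))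
      (∏ i : Fin d, srwHeatKernel (t / d) (x i)) := by
  have hd' : (d : ℝ) ≠ 0 := by exact_mod_cast (by omega : d ≠ 0)
  have hv : (∏ i : Fin d, srwHeatKernel (t / d) (x i))
      = Real.exp (-t) * ∏ i : Fin d, besselI (x i) (t / d) := by
    simp_rw [srwHeatKernel_eq_exp_neg_mul_besselI]
    rw [prod_mul_distrib, prod_const, card_univ, Fintype.card_fin, ← Real.exp_nat_mul]
    congr 2
    field_simp
  rw [hv]
  exact (hasSum_srwLaw_egf x t).mul_left (Real.exp (-t))

end Literature.Probability.FitznerVanDerHofstad2017
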